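import Summits.HodgeConjecture.HodgeConjecture.Theorems.Ring2WeilCoverageRealGeneratorTypes
import Summits.HodgeConjecture.HodgeConjecture.Theorems.Ring2WeilCoverageCyclotomicSignaturesG6
import Summits.HodgeConjecture.HodgeConjecture.Theorems.Ring2WeilCoverageCyclotomicUnconditional
import Summits.HodgeConjecture.HodgeConjecture.Theorems.Ring2WeilCoverageResidueDictionaryPiecesB
import HarnessLib

/-!
# Weil-type family coverage — THE QUADRATIC-SURD TYPE AT LEVEL `36`: every `ℚ(√−3)`-balanced CM type of `ℚ(ζ₃₆)` (the NO row
# `(36, √−3)`, the `A₃₆` classes) carries a polarisation of type `(1 + 2√3)` — the prime of `ℚ(ζ₃₆)⁺` over the unramified inert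
# prime `11` — of degree `11³`, whose polarised CM points lie on the NON-SPLIT row `(3, ℚ(√−3), 11)` (S-pencil); the
# `ℚ(i)`-balanced types do not

research route conditional on HC_CM; not a corollary; Q11.4-sentence-2 already refuted in dim ≥ 3.

Ring 2, WEIL-TYPE FAMILY-COVERAGE CENSUS (`HOME/WEIL-FAMILY-COVERAGE.md` `## b01`, blocks b01.17 (`A₃₆` on `(3, ℚ(√−3), {3, p})`,
`p ≡ 11 (12)`, by exact periods), b01.34, b01.41; owner ring2-b01), part 54c of the `Ring2WeilCoverage*` series (part 53's engine).
`ℚ(ζ₃₆)⁺ ∋ θ₃ = ζ³ + ζ³³`, `θ₃² = 3`, real (part 30′).  `11` has order `6` mod `36` with `11³ ≡ −1`: the prime of `ℚ(ζ₃₆)⁺` above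
`11` is INERT in `ℚ(ζ₃₆)` and principal with the surd generator `ϖ₁₁ = 1 + 2θ₃` of norm `1 − 12 = −11 < 0` — so `|A_ϖ|/2 = 3` and
the principal verdict FLIPS (parts 48/53):

* `re_sqrtThree` (**sign dictionary of `√3 ∈ ℚ(ζ₃₆)⁺`**, part 26b's piece: `Re σ_t(θ₃) < 0 ↔ t ∈ {5, 7, 17, 19, 29, 31}`,
  `(Re σ_t θ₃)² = 3`, `Im = 0`);
* `signSet_thirtySix_eleven` (`Re σ_t(ϖ₁₁) < 0 ↔ t ∈ {5,7,17,19,29,31}`; real, non-zero), `twistSetA_thirtySix`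
  (`X = N_odd ∆ A = {1, 5, 13, 17, 25, 29}`), `span_mul_span_thirtySix_eleven` (`(ϖ₁₁)(ϖ₁₁′) = (11)`: `N(𝔣₀) = 11³`);
* **`exists_type_thirtySix_eleven_sqrt_neg_three`** (EVERY `ℚ(√−3)`-balanced `Φ`: a `Φ`-positive divisor of type `(K; Φ; 𝔣₀)` on
  `ℂ^Φ/Φ(ℤ[ζ₃₆])`; `|S_Φ ∩ X| ≡ 3 + 3`), headline **`exists_surdType_thirtySix_eleven_sqrt_neg_three`**,
  `not_exists_type_thirtySix_eleven_sqrt_neg_one` (the YES row: `|S_Φ ∩ X| ≡ 6 + 3`).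

COMPONENTS (S-pencil, exact hermitian determinants, `g61/py/component_surd.py`): on the `(36, √−3)`-balanced `ℤ[ζ₃₆]`-tori the type
`(1 + 2√3)` has `a = 11³ ≡ 11`, `T(a) = {3, 11}` — **the NON-split row `(3, ℚ(√−3), 11)`** (b01.17's `A₃₆` placement, now for all
twenty `ℚ(√−3)`-balanced types, degree `1331`); on the `ℚ(i)`-balanced tori `a = −1331 < 0`.

HONEST FRAMING: torus-level statements about Shimura's divisors of type `(K; Φ; 𝔣₀)` on `ℂ^Φ/Φ(ℤ[ζ₃₆])` [Sh98 §14.3 Prop. 4–5],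
elementary arithmetic of `ℤ[ζ₃₆]` and residue combinatorics (`decide`); the component statement is S-pencil (docstring
only); nothing here is a statement about Hodge classes, `W_K`, general members or HC; `HC_CM` is used nowhere.  No `def`, no
named fact, no `sorry`.

References: [cite: Shimura1998, §14.3 Prop. 4–5, pp. 103–104]; [cite: vanGeemen1994HodgeAV, Lemma 5.2, Thm. 5.10];
[cite: Washington1997, Lemma 4.8]; census b01.17 / b01.41 (seat-derived).
-/

noncomputable section

open Polynomial NumberField Complex Finset
open scoped Real nonZeroDivisors

namespace Summit.HodgeConjecture.Ring2WeilCoverage.SurdTypesLevel36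

open Literature.AlgebraicGeometry.Motives (CMType)
open Literature.AlgebraicGeometry.HodgeTheory (IsCMTypeSet)
open Literature.AlgebraicGeometry.ComplexMultiplication.CyclotomicCMType (isCMTypeSet_residueFilter exists_apply_eq_toCircle)
open Literature.NumberTheory.ComplexMultiplication
open Summit.HodgeConjecture.Ring2WeilCoverage.RealGeneratorTypes
open Summit.HodgeConjecture.Ring2WeilCoverage.RamifiedTypes (card_inter_mod_two_eq)
open Summit.HodgeConjecture.Ring2WeilCoverage.CyclotomicPrincipalObstruction (coprime_of_apply_eq_toCircle)
open Summit.HodgeConjecture.Ring2WeilCoverage.CMTypeSetOddPositions (two_mul_card_eq_card_units)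
open Summit.HodgeConjecture.Ring2WeilCoverage.CyclotomicSignaturesG6
  (exists_units_sign_eq_thirtySix)
open Summit.HodgeConjecture.Ring2WeilCoverage.CyclotomicUnconditional
  (sq_sqrtThree complexConj_sqrtThree norm_realUnits_pos_thirtySix)
open Summit.HodgeConjecture.Ring2WeilCoverage.ResidueDictionaryPiecesB (re_embedding_sqrtThree_neg_iff)

variable {K : Type} [Field K] [NumberField K] {ζ : K}

/-- `𝐞(t) = exp(2πi t/n) ∈ ℂ` (`ZMod.toCircle`). -/
local notation3 (prettyPrint := false) "𝐞 " t:max => ((ZMod.toCircle t : Circle) : ℂ)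

section Level36

/-- the residue set `S_Φ` read at level `36`. -/
local notation3 (prettyPrint := false) "SΦ[" Φ "," z "]" =>
  (Finset.univ.filter fun t : ZMod 36 => ∃ σ ∈ (Φ : CMType K).1, σ (z : K) = 𝐞 t)

/-- part 53's twisted set `X_A` at level `36`. -/
local notation3 (prettyPrint := false) "XA36 " A:max =>
  (Finset.univ.filter fun t : ZMod 36 => t.val.Coprime 36 ∧
    ¬ (t ∈ (A : Finset (ZMod 36)) ↔ Even (Finset.card (Finset.filter (fun s : ZMod 36 => s.val.Coprime 36 ∧ s.val < t.val) Finset.univ))))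

/-- `θ₃ = ζ³ + ζ³³` (`θ₃² = 3`, real; part 30′). -/
local notation3 (prettyPrint := false) "θ3[" z "]" => ((z : K) ^ 3 + (z : K) ^ 33)

omit [NumberField K] in
/-- **The sign dictionary of `√3 ∈ ℚ(ζ₃₆)⁺`** (part 26b's piece read at level 36): for `φ ζ = 𝐞(t)`,
`Re φ(θ₃) < 0 ↔ t ∈ {5, 7, 17, 19, 29, 31}` (`2cos(πt/6) < 0`), `(Re φ θ₃)² = 3`, `Im φ θ₃ = 0`.
research route conditional on HC_CM; not a corollary; Q11.4-sentence-2 already refuted in dim ≥ 3. [cite: Washington1997, Lemma 4.8] -/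
theorem re_sqrtThree (hζ : IsPrimitiveRoot ζ 36) {φ : K →+* ℂ} {t : ZMod 36} (hφt : φ ζ = 𝐞 t) :
    ((φ (θ3[ζ])).re < 0 ↔ t ∈ ({5, 7, 17, 19, 29, 31} : Finset (ZMod 36))) ∧ (φ (θ3[ζ])).re ^ 2 = 3 ∧
      (φ (θ3[ζ])).im = 0 := by
  have ht := coprime_of_apply_eq_toCircle hζ hφt
  have k := re_embedding_sqrtThree_neg_iff (K := K) (n := 36) (by norm_num) hφt ht
  simp only [Nat.reduceDiv, Nat.reduceMul] at k
  have hdec : ∀ s : ZMod 36, s.val.Coprime 36 →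
      ((({1, 11} : Finset (ZMod 12)).image (· * ((ZMod.val s : ℕ) : ZMod 12)) = {5, 7}) ↔
        s ∈ ({5, 7, 17, 19, 29, 31} : Finset (ZMod 36))) := by
    decide
  have s3 : (φ (ζ ^ 3 + ζ ^ 33)) ^ 2 = 3 := by rw [← map_pow, sq_sqrtThree hζ, map_ofNat]
  have y3 : (φ (ζ ^ 3 + ζ ^ 33)).re ^ 2 = 3 := by
    have := congrArg Complex.re s3
    rw [pow_two, Complex.mul_re, k.2] at this
    simp only [mul_zero, sub_zero, Complex.re_ofNat] at this
    rw [pow_two]; exact this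
  exact ⟨k.1.1.trans (hdec t ht), y3, k.2⟩

/-- **`ϖ₁₁ = 1 + 2θ₃` (a generator of a prime of `ℚ(ζ₃₆)⁺` over `11`, inert in `ℚ(ζ₃₆)`):
`Re φ(ϖ₁₁) < 0 ↔ t ∈ {5, 7, 17, 19, 29, 31}`** (`2√3 > 1`); `ϖ₁₁` real, non-zero.
research route conditional on HC_CM; not a corollary; Q11.4-sentence-2 already refuted in dim ≥ 3. [folklore] -/
theorem signSet_thirtySix_eleven [IsCMField K] (hζ : IsPrimitiveRoot ζ 36) :
    (∀ (φ : K →+* ℂ) (t : ZMod 36), φ ζ = 𝐞 t →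
      ((φ (1 + 2 * θ3[ζ])).re < 0 ↔ t ∈ ({5, 7, 17, 19, 29, 31} : Finset (ZMod 36)))) ∧
    IsCMField.complexConj K (1 + 2 * θ3[ζ]) = 1 + 2 * θ3[ζ] ∧ (1 + 2 * θ3[ζ]) ≠ 0 := by
  have key : ∀ r : ℝ, r ^ 2 = 3 → ((1 + 2 * r < 0 ↔ r < 0) ∧ 1 + 2 * r ≠ 0) := fun r hr =>
    ⟨⟨fun h => by nlinarith, fun h => by nlinarith⟩, fun h => by nlinarith⟩
  have hre2 : ∀ φ : K →+* ℂ, (φ (1 + 2 * θ3[ζ])).re = 1 + 2 * (φ (θ3[ζ])).re := fun φ => by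
    rw [map_add, map_one, map_mul, map_ofNat, Complex.add_re, Complex.one_re, Complex.mul_re]
    simp
  refine ⟨fun φ t hφt => ?_, by rw [map_add, map_one, map_mul, map_ofNat, complexConj_sqrtThree hζ], fun h0 => ?_⟩
  · obtain ⟨hiff, hsq, -⟩ := re_sqrtThree hζ hφt
    rw [hre2, ← hiff]
    exact (key _ hsq).1
  · obtain ⟨φ⟩ := (inferInstance : Nonempty (K →+* ℂ))
    obtain ⟨t, -, hφt⟩ := exists_apply_eq_toCircle hζ φ
    obtain ⟨-, hsq, -⟩ := re_sqrtThree hζ hφt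
    apply (key _ hsq).2
    have := congrArg Complex.re (congrArg φ h0)
    rw [hre2, map_zero] at this
    simpa using this

/-- **`X_A = N_odd ∆ A = {1, 5, 13, 17, 25, 29}` at level `36`** for `A = {5, 7, 17, 19, 29, 31}` (`decide`; `|N_odd ∖ X| = 3`).
research route conditional on HC_CM; not a corollary; Q11.4-sentence-2 already refuted in dim ≥ 3. [folklore] -/
theorem twistSetA_thirtySix :
    XA36 ({5, 7, 17, 19, 29, 31} : Finset (ZMod 36)) = ({1, 5, 13, 17, 25, 29} : Finset (ZMod 36)) := by
  decide

omit [NumberField K] in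
/-- The integer `1 + 2Θ₃` of `𝓞 K` coerces to `ϖ₁₁`. [folklore] -/
theorem coe_surd_thirtySix (hζ : IsPrimitiveRoot ζ 36) :
    (((1 + 2 * (hζ.toInteger ^ 3 + hζ.toInteger ^ 33) : 𝓞 K)) : K) = 1 + 2 * θ3[ζ] := by
  push_cast
  rfl

omit [NumberField K] in
/-- **`(ϖ₁₁)·(ϖ₁₁′) = (11)`** in `𝓞 K`, `ϖ₁₁′ = 1 − 2θ₃` (`1 − 12 = −11`; `N(𝔣₀) = 11³`: degree `1331`).
research route conditional on HC_CM; not a corollary; Q11.4-sentence-2 already refuted in dim ≥ 3. [folklore] -/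
theorem span_mul_span_thirtySix_eleven (hζ : IsPrimitiveRoot ζ 36) :
    Ideal.span {(1 + 2 * (hζ.toInteger ^ 3 + hζ.toInteger ^ 33) : 𝓞 K)} *
      Ideal.span {(1 - 2 * (hζ.toInteger ^ 3 + hζ.toInteger ^ 33) : 𝓞 K)} = Ideal.span {(11 : 𝓞 K)} := by
  have hzK : algebraMap (𝓞 K) K hζ.toInteger = ζ := rfl
  rw [Ideal.span_singleton_mul_span_singleton, ← Ideal.span_singleton_neg (11 : 𝓞 K)]
  congr 2
  apply RingOfIntegers.ext
  push_cast; simp only [hzK, map_ofNat]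
  linear_combination (-4 : K) * sq_sqrtThree hζ

open scoped Classical in
/-- **ROW `(ℚ(ζ₃₆), ℚ(√−3))` — THE TYPE `(1 + 2√3)` EXISTS** (→ `(3, ℚ(√−3), 11)`, degree `11³`, S-pencil): for every CM type `Φ`
balanced for `N_K = {5, 11, 17, 23, 29, 35}` and every `𝔣₀` with `𝔬𝔣₀ = (ϖ₁₁)`, a `Φ`-positive divisor of type `(K; Φ; 𝔣₀)` on
`ℂ^Φ/Φ(ℤ[ζ₃₆])` (`|S_Φ ∩ X| ≡ 3 + 3`).
research route conditional on HC_CM; not a corollary; Q11.4-sentence-2 already refuted in dim ≥ 3. [cite: Shimura1998, §14.3 Prop. 4–5, pp. 103–104] -/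
theorem exists_type_thirtySix_eleven_sqrt_neg_three [IsCMField K] [IsCyclotomicExtension {36} ℚ K]
    (hζ : IsPrimitiveRoot ζ 36) (Φ : CMType K)
    (hbal : 2 * (SΦ[Φ, ζ] ∩ ({5, 11, 17, 23, 29, 35} : Finset (ZMod 36))).card = (SΦ[Φ, ζ]).card)
    {𝔣₀ : Ideal (𝓞 (maximalRealSubfield K))}
    (h𝔣₀ : 𝔣₀.map (algebraMap (𝓞 (maximalRealSubfield K)) (𝓞 K)) =
      Ideal.span {(1 + 2 * (hζ.toInteger ^ 3 + hζ.toInteger ^ 33) : 𝓞 K)}) :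
    ∃ ζ' : K, IsCMField.complexConj K ζ' = -ζ' ∧ (∀ φ : Φ.1, 0 < (φ.1 ζ').im) ∧
        CMTypeLattice.IsOfType (1 : (FractionalIdeal (𝓞 K)⁰ K)ˣ) ζ' 𝔣₀ := by
  have hg : Nat.totient 36 = 2 * (5 + 1) := by decide
  obtain ⟨hA, hreal, h0⟩ := signSet_thirtySix_eleven hζ
  refine exists_type_of_even' hζ hg hreal h0 (coe_surd_thirtySix hζ) hA Φ h𝔣₀ (exists_units_sign_eq_thirtySix hζ Φ) ?_
  rw [twistSetA_thirtySix]
  have hS := isCMTypeSet_residueFilter hζ Φ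
  have hX : IsCMTypeSet 36 ({1, 5, 13, 17, 25, 29} : Finset (ZMod 36)) := by decide
  have hNK : IsCMTypeSet 36 ({5, 11, 17, 23, 29, 35} : Finset (ZMod 36)) := by decide
  have h1 := card_inter_mod_two_eq hS hX hNK
  have h2 := two_mul_card_eq_card_units hS
  have hU : (Finset.univ.filter fun t : ZMod 36 => t.val.Coprime 36).card = 12 := by decide
  have h3 : (({1, 5, 13, 17, 25, 29} : Finset (ZMod 36)) \ ({5, 11, 17, 23, 29, 35} : Finset (ZMod 36))).card = 3 := by decide
  rw [Nat.even_iff]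
  omega

open scoped Classical in
/-- **ROW `(ℚ(ζ₃₆), ℚ(√−3))`, headline: `∃ 𝔣₀`, `𝔬𝔣₀·(1 − 2θ₃) = (11)`, and a `Φ`-positive divisor of type `(K; Φ; 𝔣₀)` on
`ℂ^Φ/Φ(ℤ[ζ₃₆])`** for every `ℚ(√−3)`-balanced CM type `Φ` (degree `11³`; S-pencil: on `(3, ℚ(√−3), 11)`).
research route conditional on HC_CM; not a corollary; Q11.4-sentence-2 already refuted in dim ≥ 3. [cite: Shimura1998, §14.3 Prop. 4–5, pp. 103–104] -/
theorem exists_surdType_thirtySix_eleven_sqrt_neg_three [IsCMField K] [IsCyclotomicExtension {36} ℚ K]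
    (hζ : IsPrimitiveRoot ζ 36) (Φ : CMType K)
    (hbal : 2 * (SΦ[Φ, ζ] ∩ ({5, 11, 17, 23, 29, 35} : Finset (ZMod 36))).card = (SΦ[Φ, ζ]).card) :
    ∃ 𝔣₀ : Ideal (𝓞 (maximalRealSubfield K)),
      𝔣₀.map (algebraMap (𝓞 (maximalRealSubfield K)) (𝓞 K)) *
          Ideal.span {(1 - 2 * (hζ.toInteger ^ 3 + hζ.toInteger ^ 33) : 𝓞 K)} = Ideal.span {(11 : 𝓞 K)} ∧
      ∃ ζ' : K, IsCMField.complexConj K ζ' = -ζ' ∧ (∀ φ : Φ.1, 0 < (φ.1 ζ').im) ∧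
        CMTypeLattice.IsOfType (1 : (FractionalIdeal (𝓞 K)⁰ K)ˣ) ζ' 𝔣₀ := by
  obtain ⟨-, hreal, -⟩ := signSet_thirtySix_eleven hζ
  obtain ⟨𝔣₀, h𝔣₀⟩ := exists_ideal_map_eq_span (coe_surd_thirtySix hζ) hreal
  exact ⟨𝔣₀, by rw [h𝔣₀]; exact span_mul_span_thirtySix_eleven hζ,
    exists_type_thirtySix_eleven_sqrt_neg_three hζ Φ hbal h𝔣₀⟩

open scoped Classical in
/-- **Row `(ℚ(ζ₃₆), ℚ(i))` (YES for principal) does NOT carry the type `(1 + 2√3)`** (`N_K = {7, 11, 19, 23, 31, 35}`;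
THEOREM L (i) at 36 + `|S_Φ ∩ X| ≡ 6 + 3`).
research route conditional on HC_CM; not a corollary; Q11.4-sentence-2 already refuted in dim ≥ 3. [cite: Shimura1998, §14.3 Prop. 5, p. 104] -/
theorem not_exists_type_thirtySix_eleven_sqrt_neg_one [IsCMField K] [IsCyclotomicExtension {36} ℚ K]
    (hζ : IsPrimitiveRoot ζ 36) (Φ : CMType K)
    (hbal : 2 * (SΦ[Φ, ζ] ∩ ({7, 11, 19, 23, 31, 35} : Finset (ZMod 36))).card = (SΦ[Φ, ζ]).card)
    {𝔣₀ : Ideal (𝓞 (maximalRealSubfield K))}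
    (h𝔣₀ : 𝔣₀.map (algebraMap (𝓞 (maximalRealSubfield K)) (𝓞 K)) =
      Ideal.span {(1 + 2 * (hζ.toInteger ^ 3 + hζ.toInteger ^ 33) : 𝓞 K)}) :
    ¬ ∃ ζ' : K, IsCMField.complexConj K ζ' = -ζ' ∧ (∀ φ : Φ.1, 0 < (φ.1 ζ').im) ∧
        CMTypeLattice.IsOfType (1 : (FractionalIdeal (𝓞 K)⁰ K)ˣ) ζ' 𝔣₀ := by
  have hg : Nat.totient 36 = 2 * (5 + 1) := by decide
  obtain ⟨hA, hreal, h0⟩ := signSet_thirtySix_eleven hζ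
  refine not_exists_type_of_norm_pos_of_odd' hζ hg hreal h0 (coe_surd_thirtySix hζ) hA Φ h𝔣₀
    (norm_realUnits_pos_thirtySix hζ) ?_
  rw [twistSetA_thirtySix]
  have hS := isCMTypeSet_residueFilter hζ Φ
  have hX : IsCMTypeSet 36 ({1, 5, 13, 17, 25, 29} : Finset (ZMod 36)) := by decide
  have hNK : IsCMTypeSet 36 ({7, 11, 19, 23, 31, 35} : Finset (ZMod 36)) := by decide
  have h1 := card_inter_mod_two_eq hS hX hNK
  have h2 := two_mul_card_eq_card_units hS
  have hU : (Finset.univ.filter fun t : ZMod 36 => t.val.Coprime 36).card = 12 := by decide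
  have h3 : (({1, 5, 13, 17, 25, 29} : Finset (ZMod 36)) \ ({7, 11, 19, 23, 31, 35} : Finset (ZMod 36))).card = 6 := by decide
  rw [Nat.odd_iff]
  omega

end Level36


end Summit.HodgeConjecture.Ring2WeilCoverage.SurdTypesLevel36

end
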